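import Mathlib.MeasureTheory.Integral.IntervalIntegral.Basic
import Literature.Analysis.FunctionSpaces.TorusFluidGlue
import Literature.Analysis.FluidPDE.AnomalousDissipation
import HarnessLib

/-!
# Barrier (AnomalousDissipation): no finite-time anomalous dissipation before an Euler
singularity (convergence to classical Euler solutions)
(D-0021 barrier catalogue for `Summits/AnomalousDissipation`; summit statement
`AnomalousDissipation := Literature.Turb.ZerothLaw`)

Bruè–De Lellis, *Anomalous dissipation for the forced 3D Navier–Stokes equations*, CMP 400
(2023), §1 and the Appendix (Lemma 7 in the arXiv numbering): if the forces `f^ν` and data `u₀^ν` "enjoy uniform bounds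
in some space of smooth functions and hence converge" to `f, u₀` for which the forced Euler
equations have a Lipschitz solution `u` on `[0,T]`, then classical Navier–Stokes solutions `u^ν`
converge to `u` strongly in `C([0,T]; L²(T³))` as `ν → 0` (`f^ν → f` in `L¹(0,T; L²)`,
`u^ν(0) → u(0)` in `L²`), and "from this strong convergence, it is then elementary to infer that
[anomalous dissipation on `[0,T]`] cannot hold": anomalous dissipation with uniformly smooth data
and forces "can only hold if `T` is larger than the first blow-up time of some suitable classical
solution of the incompressible Euler equations", so that proving it "would settle, as a corollary,
the blow-up problem of incompressible Euler … (on the negative)" (op. cit. §1). The general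
principle (any sufficiently regular Euler solution attracts every reasonable regularisation,
in particular Leray solutions) is credited there to Brenier–De Lellis–Székelyhidi (CMP 305
(2011)); Constantin (Bull. AMS 44 (2007), §3.1) records that the finite-time zero-viscosity
limit "holds for as long as the Euler solution is smooth" and contrasts it with the long-time,
zero-viscosity limit relevant to turbulence.

## What is vendored

* `BrueDeLellis2023_lemma7_convergence` — the convergence statement printed after Lemma 7
  (Appendix), for classical solutions on the flat unit torus `T³` (accepted
  `Torus.IsClassicalNSSolutionOn`; the Euler solution is a classical solution with `ν = 0` on
  `[0,T]`, hence Lipschitz in space uniformly on the compact `[0,T] × T³`, which is the printed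
  hypothesis "Lipschitz solution"). Norms: Mathlib's `eLpNorm · 2 volume` on time slices, the
  interval integral for `L¹(0,T; L²)`.
* `BrueDeLellis2023_noAnomaly_beforeEulerSingularity` — the consequence stated in §1 (no
  anomalous dissipation on `[0,T]` under the same convergence hypotheses), with the accepted
  `Torus.cumulativeDissipation ν u 0 T = ν ∫₀ᵀ ‖∇u(t)‖₂² dt`. The barrier block sits here.
  Proved corollary `BrueDeLellis2023_noAnomaly_beforeEulerSingularity.not_hasAnomalousDissipation`: at `T = 1` the family has
  `¬ Literature.Turb.HasAnomalousDissipation` (the accepted `ε`-form of `liminf > 0` used by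
  `Literature.Turb.BrueDeLellisQuestion21/22`).
* *Scope.* Both facts take the Euler solution classical (`C^∞`, the accepted
  `Torus.IsClassicalNSSolutionOn` with `ν = 0`), narrower than the printed "Lipschitz solution";
  only classical Navier–Stokes families are covered (the Leray case of the general principle is
  a whole-space companion barrier, proposed separately, after Brenier–De Lellis–Székelyhidi);
  see the `scope_caveats:` line.
* *Narrowed companion (D-0021 barrier audit).* `BrueDeLellis2023_noAnomaly_beforeEulerSingularityNarrow`
  records exactly what the facts block of the `ν`-independent-force questions: the hub-form
  `Literature.Analysis.FluidPDE.BrueDeLellisQuestion21` (single force in `C^∞([0,1] × T³)`) is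
  incompatible with classical solvability of smooth-forced Euler on `T³` over `[0,1]` (every
  smooth divergence-free datum and smooth force admit a classical forced-Euler solution on
  `[0,1]`, i.e. no finite-time breakdown of smooth-forced Euler on `T³` in the unit-time
  normalisation) — proved below from the named fact
  (`BrueDeLellis2023_noAnomaly_beforeEulerSingularity.narrow`, with `.not_question22`). The audit
  found the printed Question 2.1 weaker than the hub form (a single `f ∈ ⋂_{α<1} C^α`, below the
  `C¹` well-posedness borderline, where the facts are silent), the blow-up "corollary" deterrent
  regularity-class dependent (forced Euler blow-up with `C^{3,1/2}` data — `C^∞` per Remark 1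
  there, unproved — and force uniformly in `C^{1,1/2−ε}` is a theorem on `ℝ³`,
  Córdoba–Martínez-Zoroa 2023; with `C^{1,α}` data and force already Elgindi 2021, Remark 1.4),
  and the no-boundary setting
  essential (Kato's criterion); see the `evasions_known:`/`scope_caveats:` lines of both blocks.

## References

* E. Bruè, C. De Lellis, Comm. Math. Phys. 400 (2023) 1507–1533, §1, §2 (Questions 2.1–2.4) and the Appendix,
  Lemma 7 in the arXiv numbering (arXiv:2207.06301, §9).
* P. Constantin, Bull. Amer. Math. Soc. 44 (2007), §3.1–3.2.
* Y. Brenier, C. De Lellis, L. Székelyhidi, Comm. Math. Phys. 305 (2011) (weak–strong uniqueness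
  for measure-valued solutions; cited by Bruè–De Lellis for the general principle).
* D. Córdoba, L. Martínez-Zoroa, *Blow-up for the incompressible 3D-Euler equations with uniform
  `C^{1,1/2−ε} ∩ L²` force*, arXiv:2309.08495 (2023), Thm. 1.1 and Remarks 1–3.
* A. F. Vasseur, J. Yang, *Layer separation of the 3D incompressible Navier–Stokes equation in a
  bounded domain*, Comm. PDE (2024) = arXiv:2303.05236, §1 (Kato's criterion, Thm. 1).
* J. Chen, T. Y. Hou, Proc. Natl. Acad. Sci. 122 (2025) (smooth-data Euler blow-up with boundary).
-/

open MeasureTheory Set Filter Topology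
open scoped ENNReal NNReal

noncomputable section

namespace Literature.Barriers.AnomalousDissipation

/-- The flat three-torus `T³ = (ℝ/ℤ)³` (local notation). -/
local notation "𝕋³" => UnitAddTorus (Fin 3)
/-- Velocity values (local notation). -/
local notation "E³" => EuclideanSpace ℝ (Fin 3)

/-- **Convergence of Navier–Stokes to classical solutions of forced Euler** (Bruè–De Lellis,
CMP 400 (2023), Appendix, Lemma 7 (arXiv numbering) and the sentence following it). Let `(u, p)` be a classical
(hence Lipschitz) solution of the forced Euler equations `∂ₜu + u·∇u + ∇p = f`, `div u = 0` on
`T³ × [0,T]`, and let `(u_j, p_j)` be classical solutions of Navier–Stokes with viscosities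
`ν_j ↓ 0` and forces `f_j` on `T³ × [0,T]`. If `f_j → f` in `L¹(0,T; L²(T³))` and
`u_j(0) → u(0)` in `L²(T³)`, then `u_j → u` in `C([0,T]; L²(T³))`, i.e.
`sup_{t ∈ [0,T]} ‖u_j(t) - u(t)‖_{L²} → 0`. (Lemma 7 is the Grönwall inequality
`d/dt ½‖u - u^ν‖² ≤ (‖∇u‖_∞ + ½)‖u - u^ν‖² + ½‖f - f^ν‖² + (ν/4)‖∇u‖²` from which this is read
off.) [cite: BrueDeLellis2023, Appendix, Lemma 7 (arXiv numbering)] -/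
def BrueDeLellis2023_lemma7_convergence : Prop :=
  ∀ (T : ℝ) (_hT : 0 < T) (f u : ℝ → 𝕋³ → E³) (p : ℝ → 𝕋³ → ℝ)
    (_hEuler : Literature.Analysis.FunctionSpaces.Torus.IsClassicalNSSolutionOn (Icc 0 T) 0 f u p)
    (ν : ℕ → ℝ) (_hν : ∀ j, 0 < ν j) (_hν₀ : Tendsto ν atTop (𝓝 0))
    (fs us : ℕ → ℝ → 𝕋³ → E³) (ps : ℕ → ℝ → 𝕋³ → ℝ)
    (_hNS : ∀ j, Literature.Analysis.FunctionSpaces.Torus.IsClassicalNSSolutionOn (Icc 0 T) (ν j) (fs j) (us j) (ps j))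
    (_hforce : Tendsto (fun j => ∫ t in (0 : ℝ)..T, (eLpNorm (fs j t - f t) 2 volume).toReal)
      atTop (𝓝 0))
    (_hdata : Tendsto (fun j => eLpNorm (us j 0 - u 0) 2 volume) atTop (𝓝 0)),
    Tendsto (fun j => ⨆ t ∈ Icc 0 T, eLpNorm (us j t - u t) 2 volume) atTop (𝓝 0)

/-- **No anomalous dissipation on `[0,T]` before the first Euler singularity** (Bruè–De Lellis,
CMP 400 (2023), §1, discussion following the statement of the zeroth law, with the Appendix): in the situation of
`BrueDeLellis2023_lemma7_convergence` — classical forced Euler solution `(u,p)` on `[0,T]`,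
classical Navier–Stokes solutions `(u_j,p_j)` with `ν_j ↓ 0`, forces `f_j → f` in
`L¹(0,T; L²)`, data `u_j(0) → u(0)` in `L²` — the energy dissipation on `[0,T]` vanishes in the
limit: `ν_j ∫₀ᵀ ‖∇u_j(t)‖²_{L²} dt → 0`; in the words of the source, anomalous dissipation with
uniformly smooth forces and data "can only hold if `T` is larger than the first blow-up time of
some suitable classical solution of the incompressible Euler equations".

BARRIER (D-0021):
- technique_class: finite-time fixed-smooth-data uniformly-smooth-forcing classical-euler-limit short-time
- blocks: finite-window readings of the summit with `ν`-independent smooth data and force *below the classical lifespan of the limiting forced Euler problem*: for classical Navier–Stokes families with `f_j → f` in `L¹(0,T;L²)`, `u_j(0) → u(0)` in `L²` and a classical forced Euler solution `(u,p)` on `[0,T]`, the dissipation `ν_j∫₀ᵀ‖∇u_j‖²` tends to `0` [cite: BrueDeLellis2023, §1 and Appendix, Lemma 7 (arXiv numbering)]; thereby the fixed-window statements `Literature.Analysis.FluidPDE.BrueDeLellisQuestion21` / `Literature.Analysis.FluidPDE.BrueDeLellisQuestion22` (window `[0,1]`, fixed smooth datum, `ν`-independent smooth force) are *reduced* to loss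 of classical regularity of the forced Euler solution of `(u₀,f)` before `t = 1` — "proving [anomalous dissipation] for sequences `u₀^ν` and `f^ν` which satisfy good uniform bounds would settle, as a corollary, the blow-up problem of incompressible Euler … (on the negative)" [cite: BrueDeLellis2023, §1] — not refuted; the summit `Literature.Turb.ZerothLaw` itself (long-time averages, `ν`-dependent data, Leray–Hopf solutions) is not touched by the vendored facts.
- because: Grönwall on `½‖u - u^ν‖²_{L²}` using the Lipschitz bound of the Euler solution gives `u^ν → u` in `C([0,T]; L²)` [cite: BrueDeLellis2023, Appendix, Lemma 7 (arXiv numbering)]; passing to the limit in the energy balance `ν∫₀ᵀ‖∇u^ν‖² = ½‖u^ν(0)‖² - ½‖u^ν(T)‖² + ∫₀ᵀ∫ f^ν·u^ν` and using energy conservation of the Lipschitz Euler solution the right-hand side tends to `0` [cite: BrueDeLellis2023, §1, energy balance, and Appendix]; the finite-time and the long-time zero-viscosity limits "are not the same", the finite-time limit "holds for as long as the Euler solution is smooth" [cite: Constantin2007, §3.1].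
- evasions_known: take long-time averages before `ν → 0` (the summit's own form, `limsup_{T→∞}` means; "the physical context for anomalous dissipation is … the long-time limit, in the presence of forces" [cite: Constantin2007, §3.2]; realised for time-periodic smooth solutions with `f^ν → f` [cite: Cheskidov2023, Thm. 1.3] (`Literature.Analysis.FluidPDE.cheskidov_time_periodic_anomaly`)); or inject the irregularity through the force while keeping the datum fixed and smooth — forces bounded only in `C⁰_t C^α_x`, `α < 1`, below the Lipschitz threshold [cite: BrueDeLellis2023, Thm. 1.1]; or let the data carry `ν`-dependent small scales ("nested" initialisation) [cite: DrivasEyink2019, Remark 4]; or keep datum and force `ν`-independent with the force only `C^{1,α}` in space (above the Lipschitz threshold, so the facts do apply on short windows) and let the window contain a proven blow-up time of the forced Euler solution — finite-time loss of Lipschitz regularity (`∫₀ᵗ‖∇u‖_∞ → ∞`) with a force uniformly in `C^{1,1/2−ε} ∩ L²` and data in `C^{3,1/2} ∩ L²` (`C^∞` data and force on `[0,T−δ]` per Remark 1 there, stated without proof) is established on `ℝ³` [cite: CordobaMartinezZoroa2023, Thm. 1.1 and Remarks 1–3] (periodic analogue not in print), and with `C^{1,α}` data a compactly supported finite-energy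 blow-up with compactly supported forcing uniformly `C^{1,α}` up to the blow-up time is noted in [cite: Elgindi2021AnnMath, Remark 1.4]; past that time the facts are silent (see `BrueDeLellis2023_noAnomaly_beforeEulerSingularityNarrow`).
- scope_caveats: (a) the Euler solution is taken classical (`C^∞` velocity and pressure on `[0,T] × T³`), narrower than the printed hypothesis "Lipschitz solution of [forced Euler]" [cite: BrueDeLellis2023, Appendix, Lemma 7 (arXiv numbering)]; (b) only classical Navier–Stokes sequences are covered — the source remarks that the computation "can be generalized to … distributional solutions that satisfy a suitable form of the global energy inequality" without details [cite: BrueDeLellis2023, Appendix], and the Leray-solution case of the general principle (Brenier–De Lellis–Székelyhidi, whole space, unforced) is not vendored in this file; (c) the facts bear on `Literature.Turb.BrueDeLellisQuestion21/22` only while the forced Euler solution of the limiting `(u₀,f)` stays classical on `[0,1]` (they reduce those questions to Euler blow-up before `t = 1`, they do not refute them), and they say nothing about the summit `Literature.Turb.ZerothLaw` (long-time `limsup` averages, `ν`-dependent data `u₀ⱼ`, Leray–Hopf solutions), nor about forces converging only in topologies weaker than `L¹(0,T;L²)` or data not converging in `L²`; (d) the reduction of `Literature.Analysis.FluidPDE.BrueDeLellisQuestion21/22`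 in `blocks:` uses that the hub formalisation takes the `ν`-independent force in `C^∞([0,1] × T³)` (resp. `C^∞(T³)`): the printed Question 2.1 asks for a single `f ∈ ⋂_{α<1} C^α` [cite: BrueDeLellis2023, §2, Question 2.1], below the `C¹` borderline of classical well-posedness [cite: BrueDeLellis2023, §1], for which no Lipschitz Euler solution need exist on any `[0,T₀]` (e.g. `u₀ = 0`, `f = (φ(x₂),0,0)` with `φ ∈ ⋂_{α<1}C^α ∖ Lip`, `u = t f`) and the facts say nothing — the exact content of the reduction is `BrueDeLellis2023_noAnomaly_beforeEulerSingularityNarrow`; (e) the source's deterrent "would settle, as a corollary, the blow-up problem of incompressible Euler … (on the negative)" is regularity-class dependent [cite: BrueDeLellis2023, §1]: open for `C^∞` (or `C²`) data and force on `T³`, established for `C^{1,α}` data on `ℝ³`, unforced [cite: Elgindi2021AnnMath, Thm. 1] or with a compactly supported force uniformly `C^{1,α}` [cite: Elgindi2021AnnMath, Remark 1.4], for `C^{3,1/2}` data (`C^∞` per Remark 1 there, unproved) with force uniformly in `C^{1,1/2−ε} ∩ L²` on `ℝ³` [cite: CordobaMartinezZoroa2023, Thm. 1.1], and for smooth data in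 the presence of a solid boundary [cite: ChenHou2025]; (f) no boundary: the facts are on `T³`; on domains with no-slip walls the same conclusion under the same convergence hypotheses on data and forces is open even in two dimensions — it is the layer-separation problem governed by Kato's criterion [cite: VasseurYang2023, §1, Thm. 1 (Kato's criterion)].
- status: established (theorem) [cite: BrueDeLellis2023, §1 and Appendix] -/
def BrueDeLellis2023_noAnomaly_beforeEulerSingularity : Prop :=
  ∀ (T : ℝ) (_hT : 0 < T) (f u : ℝ → 𝕋³ → E³) (p : ℝ → 𝕋³ → ℝ)
    (_hEuler : Literature.Analysis.FunctionSpaces.Torus.IsClassicalNSSolutionOn (Icc 0 T) 0 f u p)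
    (ν : ℕ → ℝ) (_hν : ∀ j, 0 < ν j) (_hν₀ : Tendsto ν atTop (𝓝 0))
    (fs us : ℕ → ℝ → 𝕋³ → E³) (ps : ℕ → ℝ → 𝕋³ → ℝ)
    (_hNS : ∀ j, Literature.Analysis.FunctionSpaces.Torus.IsClassicalNSSolutionOn (Icc 0 T) (ν j) (fs j) (us j) (ps j))
    (_hforce : Tendsto (fun j => ∫ t in (0 : ℝ)..T, (eLpNorm (fs j t - f t) 2 volume).toReal)
      atTop (𝓝 0))
    (_hdata : Tendsto (fun j => eLpNorm (us j 0 - u 0) 2 volume) atTop (𝓝 0)),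
    Tendsto (fun j => Literature.Analysis.FunctionSpaces.Torus.cumulativeDissipation (ν j) (us j) 0 T) atTop (𝓝 0)

/-- **Corollary (window `[0,1]`, `ε`-form).** Under the hypotheses of
`BrueDeLellis2023_noAnomaly_beforeEulerSingularity` on the window `[0,1]` — a classical forced
Euler solution on `[0,1]`, classical Navier–Stokes solutions with `ν_j ↓ 0`, forces
`f_j → f` in `L¹(0,1; L²)`, data `u_j(0) → u(0)` in `L²` — the family does **not** dissipate
anomalously in the sense of `Literature.Analysis.FluidPDE.HasAnomalousDissipation` (the accepted `ε`-form of
`liminf_j ν_j∫₀¹‖∇u_j‖² > 0` used in `Literature.Turb.BrueDeLellisQuestion21/22`): Bruè–De Lellis, CMP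
400 (2023), §1, "(anomalous dissipation) can only hold if `T` is larger than the first blow-up
time of some suitable classical solution of the incompressible Euler equations". Proved from
the named fact via `Literature.Analysis.FluidPDE.not_hasAnomalousDissipation_of_tendsto_zero`.
[cite: BrueDeLellis2023, §1] -/
theorem BrueDeLellis2023_noAnomaly_beforeEulerSingularity.not_hasAnomalousDissipation
    (h : BrueDeLellis2023_noAnomaly_beforeEulerSingularity) (f u : ℝ → 𝕋³ → E³)
    (p : ℝ → 𝕋³ → ℝ) (hEuler : Literature.Analysis.FunctionSpaces.Torus.IsClassicalNSSolutionOn (Icc 0 1) 0 f u p)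
    (ν : ℕ → ℝ) (hν : ∀ j, 0 < ν j) (hν₀ : Tendsto ν atTop (𝓝 0))
    (fs us : ℕ → ℝ → 𝕋³ → E³) (ps : ℕ → ℝ → 𝕋³ → ℝ)
    (hNS : ∀ j, Literature.Analysis.FunctionSpaces.Torus.IsClassicalNSSolutionOn (Icc 0 1) (ν j) (fs j) (us j) (ps j))
    (hforce : Tendsto (fun j => ∫ t in (0 : ℝ)..1, (eLpNorm (fs j t - f t) 2 volume).toReal)
      atTop (𝓝 0))
    (hdata : Tendsto (fun j => eLpNorm (us j 0 - u 0) 2 volume) atTop (𝓝 0)) :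
    ¬ Literature.Analysis.FluidPDE.HasAnomalousDissipation ν us :=
  Literature.Analysis.FluidPDE.not_hasAnomalousDissipation_of_tendsto_zero
    (h 1 one_pos f u p hEuler ν hν hν₀ fs us ps hNS hforce hdata)

/-! ## Narrowed companion (D-0021 barrier audit): what is blocked of Questions 2.1/2.2 -/

/-- **Narrowed barrier: no anomalous dissipation with a `ν`-independent smooth force unless
smooth-forced Euler breaks down on `T³`** (Bruè–De Lellis, CMP 400 (2023), §1 with the Appendix,
Lemma 7 (arXiv numbering), read against §2, Question 2.1). The exact content of the reduction
claimed in the `blocks:` line of `BrueDeLellis2023_noAnomaly_beforeEulerSingularity`. The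
hypothesis is *classical solvability of smooth-forced Euler on `T³` over the unit window*: every
smooth divergence-free datum `u₀` and every force `f ∈ C^∞([0,1] × T³)` admit a classical
solution `(u,p)` of `∂ₜu + (u·∇)u + ∇p = f`, `div u = 0` on `[0,1]` (the accepted
`Torus.IsClassicalNSSolutionOn` with `ν = 0`) with `u(0) = u₀` — the negation of finite-time
breakdown for `C^∞` data and force in the unit-time normalisation (by the scaling
`u_λ(t,x) = λu(λt,x)`, `p_λ = λ²p(λt,·)`, `f_λ = λ²f(λt,·)` on the fixed torus, the same as
classical solvability on every `[0,T]`), **open** on `T³`: "The problem of blow-up of classical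
solutions of Euler for more regular initial data and force (e.g. `C²`) is still widely open"
[cite: BrueDeLellis2023, §1]. The conclusion: the hub-form Question 2.1
(`Literature.Analysis.FluidPDE.BrueDeLellisQuestion21`: fixed smooth datum, a single force
`f ∈ C^∞([0,1] × T³)`, classical Navier–Stokes solutions, `liminf_m ν_m∫₀¹‖∇u_m‖² > 0`) has a
negative answer; equivalently, a positive answer must exhibit a smooth `(u₀, f)` whose forced
Euler problem has no classical solution on `[0,1]`.

BARRIER (D-0021):
- technique_class: finite-window nu-independent-smooth-force fixed-smooth-data classical-navier-stokes periodic-box below-euler-breakdown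
- blocks: positive answers to the hub-form `Literature.Analysis.FluidPDE.BrueDeLellisQuestion21` (and, via `Literature.Analysis.FluidPDE.BrueDeLellisQuestion22.question21`, to `BrueDeLellisQuestion22`, see `.not_question22`) by any family whose limiting smooth-forced Euler problem `(u₀, f)` stays classical on `[0,1]` — in particular every architecture in which smooth-forced Euler is globally classical (two-dimensional and `2½`-dimensional/shear constructions with a smooth `ν`-independent force, where the transported component is a passive scalar driven by a smooth, hence Lipschitz, limiting field); jointly, "smooth-forced Euler classically solvable on `[0,1]` for all smooth data and forces" and `BrueDeLellisQuestion21` are contradictory [cite: BrueDeLellis2023, §1 and Appendix, Lemma 7 (arXiv numbering)].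
- because: apply `BrueDeLellis2023_noAnomaly_beforeEulerSingularity` on `[0,1]` with `f_j = f` (so `∫₀¹‖f_j − f‖_{L²} = 0`) and `u_j(0) = u₀ = u(0)` to the classical Euler solution supplied by the hypothesis (`u₀ = u_j(0)` is divergence free): `ν_j∫₀¹‖∇u_j‖² → 0`, contradicting `HasAnomalousDissipation` (`Literature.Analysis.FluidPDE.not_hasAnomalousDissipation_of_tendsto_zero`) [cite: BrueDeLellis2023, Appendix, Lemma 7 (arXiv numbering)].
- evasions_known: (1) the printed Question 2.1 asks only for a single `f ∈ ⋂_{α<1} C^α` [cite: BrueDeLellis2023, §2, Question 2.1], below the `C¹` borderline of classical well-posedness [cite: BrueDeLellis2023, §1]: then no Lipschitz Euler solution need exist on any `[0,T₀]` (e.g. `u₀ = 0`, `f = (φ(x₂),0,0)`, `φ ∈ ⋂_{α<1}C^α ∖ Lip`, `u = t f`) and neither this statement nor its parent says anything — the roughness sits in the fixed force rather than in its `ν`-dependence; (2) `ν`-independent forces of intermediate regularity `C^{1,α}` — above Lipschitz, so the parent fact applies on short windows — admit proven finite-time loss of Lipschitz regularity of forced Euler from regular data: on `ℝ³`, force uniformly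 in `C^{1,1/2−ε} ∩ L²`, velocity in `C^{3,1/2} ∩ L²` on `[0,T)` (`C^∞` on `[0,T−δ]` per Remark 1, stated there without proof), `∫₀ᵗ‖∇u‖_∞ → ∞` [cite: CordobaMartinezZoroa2023, Thm. 1.1 and Remarks 1–3]; with `C^{1,α}` data, compactly supported forcing uniformly `C^{1,α}` up to the blow-up time [cite: Elgindi2021AnnMath, Remark 1.4]; on windows containing that time the classical-Euler-limit argument is void by a theorem rather than by an open problem (periodic analogue not in print); (3) the evasions of the parent block: long-time averages [cite: Constantin2007, §3.2], [cite: Cheskidov2023, Thm. 1.3]; `ν`-dependent forces bounded only in `C⁰_tC^α_x`, `α < 1` [cite: BrueDeLellis2023, Thm. 1.1]; `ν`-dependent data [cite: DrivasEyink2019, Remark 4].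
- scope_caveats: (a) a reduction, not a refutation: the hypothesis is open on `T³` [cite: BrueDeLellis2023, §1] (the known Euler blow-ups need `C^{1,α}` data on `ℝ³` [cite: Elgindi2021AnnMath, Thm. 1 and Remark 1.4], `C^{3,1/2}` data with a force only uniformly `C^{1,1/2−ε}` on `ℝ³` [cite: CordobaMartinezZoroa2023, Thm. 1.1 and Remark 1], or a solid boundary [cite: ChenHou2025]); (b) periodic box `T³` only — with no-slip boundaries the absence of anomalous dissipation near a regular Euler solution under the same convergence of data and forces is open even in 2D (Kato's criterion) [cite: VasseurYang2023, §1, Thm. 1 (Kato's criterion)]; (c) classical (`C^∞`) Navier–Stokes solutions on the closed window and the `ε`-form `HasAnomalousDissipation` of `liminf > 0`, as in the hub statements; (d) says nothing about the summit `Literature.Turb.ZerothLaw` (long-time averages, Leray–Hopf solutions).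
- status: established (theorem) — `BrueDeLellis2023_noAnomaly_beforeEulerSingularity.narrow` below, from the parent fact (itself discharged in the sibling proof file) [cite: BrueDeLellis2023, §1 and Appendix] -/
def BrueDeLellis2023_noAnomaly_beforeEulerSingularityNarrow : Prop :=
  (∀ (u₀ : 𝕋³ → E³) (f : ℝ → 𝕋³ → E³),
      Literature.Analysis.FunctionSpaces.Torus.IsSmooth u₀ →
      Literature.Analysis.FunctionSpaces.Torus.IsDivFree u₀ →
      Literature.Analysis.FunctionSpaces.Torus.IsSmoothSpaceTimeOn (Icc 0 1) f →
      ∃ (u : ℝ → 𝕋³ → E³) (p : ℝ → 𝕋³ → ℝ),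
        Literature.Analysis.FunctionSpaces.Torus.IsClassicalNSSolutionOn (Icc 0 1) 0 f u p ∧
          u 0 = u₀) →
    ¬ Literature.Analysis.FluidPDE.BrueDeLellisQuestion21

/-- The narrowed barrier follows from the named fact: given witnesses `(ν, u₀, f, u_m, p_m)` of the
hub-form Question 2.1 and a classical forced-Euler solution `(u, p)` on `[0,1]` with `u(0) = u₀`
(from the solvability hypothesis; `u₀ = u_m(0)` is divergence free), the fact with `f_j = f`,
`u_j(0) = u(0)` gives `ν_m∫₀¹‖∇u_m‖² → 0`, contradicting anomalous dissipation.
[cite: BrueDeLellis2023, §1 and Appendix, Lemma 7 (arXiv numbering)] -/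
theorem BrueDeLellis2023_noAnomaly_beforeEulerSingularity.narrow
    (h : BrueDeLellis2023_noAnomaly_beforeEulerSingularity) :
    BrueDeLellis2023_noAnomaly_beforeEulerSingularityNarrow := by
  rintro hreg ⟨ν, u₀, f, us, ps, hν, hu₀, hf, hsol, hAD⟩
  have h0 : (0 : ℝ) ∈ Icc (0 : ℝ) 1 := ⟨le_rfl, zero_le_one⟩
  have hdiv : Literature.Analysis.FunctionSpaces.Torus.IsDivFree u₀ := by
    rw [← (hsol 0).2]
    exact (hsol 0).1.divFree 0 h0
  obtain ⟨u, p, hE, hu0⟩ := hreg u₀ f hu₀ hdiv hf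
  have hforce : Tendsto (fun _ : ℕ => ∫ t in (0 : ℝ)..1, (eLpNorm (f t - f t) 2 volume).toReal)
      atTop (𝓝 0) := by
    have hz : (fun _ : ℕ => ∫ t in (0 : ℝ)..1, (eLpNorm (f t - f t) 2 volume).toReal) =
        fun _ => 0 := by
      funext j
      simp
    rw [hz]
    exact tendsto_const_nhds
  have hdata : Tendsto (fun j => eLpNorm (us j 0 - u 0) 2 volume) atTop (𝓝 0) := by
    have hz : (fun j => eLpNorm (us j 0 - u 0) 2 volume) = fun _ => 0 := by
      funext j
      rw [(hsol j).2, hu0, sub_self]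
      exact eLpNorm_zero
    rw [hz]
    exact tendsto_const_nhds
  exact Literature.Analysis.FluidPDE.not_hasAnomalousDissipation_of_tendsto_zero
    (h 1 one_pos f u p hE ν (fun j => hν.2.2 j) hν.2.1 (fun _ => f) us ps (fun j => (hsol j).1)
      hforce hdata) hAD

/-- The same reduction for the hub-form Question 2.2 (time-independent smooth force `f ∈ C^∞(T³)`),
through `Literature.Analysis.FluidPDE.BrueDeLellisQuestion22.question21`: under the solvability
hypothesis of `BrueDeLellis2023_noAnomaly_beforeEulerSingularityNarrow`, Question 2.2 has a
negative answer as well. [cite: BrueDeLellis2023, §2, Question 2.2] -/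
theorem BrueDeLellis2023_noAnomaly_beforeEulerSingularityNarrow.not_question22
    (hN : BrueDeLellis2023_noAnomaly_beforeEulerSingularityNarrow)
    (hreg : ∀ (u₀ : 𝕋³ → E³) (f : ℝ → 𝕋³ → E³),
      Literature.Analysis.FunctionSpaces.Torus.IsSmooth u₀ →
      Literature.Analysis.FunctionSpaces.Torus.IsDivFree u₀ →
      Literature.Analysis.FunctionSpaces.Torus.IsSmoothSpaceTimeOn (Icc 0 1) f →
      ∃ (u : ℝ → 𝕋³ → E³) (p : ℝ → 𝕋³ → ℝ),
        Literature.Analysis.FunctionSpaces.Torus.IsClassicalNSSolutionOn (Icc 0 1) 0 f u p ∧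
          u 0 = u₀) :
    ¬ Literature.Analysis.FluidPDE.BrueDeLellisQuestion22 :=
  fun hQ => hN hreg hQ.question21

end Literature.Barriers.AnomalousDissipation

end
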